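import Mathlib
import HarnessLib
import Summits.ValiantsHypothesis.ValiantsHypothesis.Theorems.PermanentalConesHyperbolicVPShadowStubLowEffGlue

/-!
# ValiantsHypothesis / PermanentalCones — `HyperbolicVPShadow`, the dimension bound `≤ 4` at `N = 3`

Route `PermanentalCones`, item `stmt-ValiantsHypothesis-8655` (crux `HyperbolicVPShadow`), line
`birth`, stub `stub_dimLeFour_of_oshime`.

The crux is reduced in the skeleton to linear pencils `P : ℝⁿ →ₗ Mat₃(ℝ)` all of whose values
have only real eigenvalues ("RS"), which are irreducible (no common invariant subspace
`0 ≠ W ≠ ℝ³` of all `P x`) and not simultaneously symmetrisable (no positive definite `S` with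
all `S · P x` symmetric). This file proves, from the two theorems of T. Oshime (1991) taken
verbatim as hypotheses —

* O₁ ((I) Thm 5.1): a nondegenerate real-diagonalizable family of `≥ 4` real `3 × 3` matrices is
  simultaneously symmetrizable by a similarity (`∃` invertible `T`, all `T⁻¹ Aᵢ T` symmetric);
* O₂ ((II) Thm 6.1 with Lemma 3.2): a nondegenerate family of `≥ 4` real `3 × 3` matrices with
  only real eigenvalues which is NOT real-diagonalizable has a common right eigenvector or a
  common left eigenvector —

that for every such pencil `P` the space `V := span (1, range P)` has dimension `≤ 4`.

Proof: if `dim V ≥ 5`, split `V = ℝ·1 ⊕ q` (a complement `q₀` of `ℝ·1` in the matrix space,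
cut down to `q := q₀ ⊓ V` by the modular law) and read a basis of `q` as a family
`A₀, …, A_{m-1}`, `m = dim V - 1 ≥ 4`; then `1, A₀, …, A_{m-1}` is linearly independent, every
real combination of the `Aᵢ` lies in `V` and so has real spectrum
(`permanentalCones_map_smul_one_add_sub` shifts the spectrum of `a·1 + P x`), and
`V ⊆ span (1, A)`. If the family `A` is real-diagonalizable, O₁ gives `T`, and
`S := (T⁻¹)ᵀ T⁻¹` is positive definite with every `S · P x = (T⁻¹)ᵀ (T⁻¹ P x T) T⁻¹` symmetric —
contradicting non-symmetrisability. Otherwise O₂ gives a common right eigenvector `v` (then the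
line `ℝ v` is invariant) or a common left eigenvector `w` (then the plane `w^⊥` is invariant) —
contradicting irreducibility. All folklore linear algebra.
-/

set_option linter.dupNamespace false

noncomputable section

namespace Summit.ValiantsHypothesis.ValiantsHypothesis.Theorems

open Matrix

/-- Congruence preserves symmetry: `Bᵀ N B` is symmetric when `N` is. [folklore] -/
theorem permanentalCones_isSymm_transpose_mul_mul {m : Type*} [Fintype m]
    {N : Matrix m m ℝ} (hN : N.IsSymm) (B : Matrix m m ℝ) : (Bᵀ * N * B).IsSymm := by
  unfold Matrix.IsSymm
  rw [Matrix.transpose_mul, Matrix.transpose_mul, Matrix.transpose_transpose, hN.eq,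
    Matrix.mul_assoc]

/-- **The dimension bound `dim span (1, range P) ≤ 4` for irreducible, not simultaneously
symmetrisable real-spectrum pencils of real `3 × 3` matrices**, from Oshime's two theorems taken
verbatim as hypotheses: O₁ — a nondegenerate real-diagonalizable family of `≥ 4` real `3 × 3`
matrices is simultaneously symmetrizable by a similarity; O₂ — a nondegenerate, not
real-diagonalizable family of `≥ 4` real `3 × 3` matrices with only real eigenvalues has a common
right or a common left eigenvector. If `dim V ≥ 5` (`V := span (1, range P)`), a basis of a
complement of `ℝ·1` in `V` is a nondegenerate family of `≥ 4` matrices all of whose real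
combinations have real spectrum; O₁ would make `P` symmetrisable by the positive definite
`(T⁻¹)ᵀ T⁻¹`, and O₂ would produce an invariant line `ℝ v` or an invariant plane `w^⊥`.
[folklore] -/
theorem stub_dimLeFour_of_oshime :
    (∀ (n : ℕ) (A : Fin n → Matrix (Fin 3) (Fin 3) ℝ), 4 ≤ n →
      LinearIndependent ℝ (Fin.cons (1 : Matrix (Fin 3) (Fin 3) ℝ) A) →
      (∀ ξ : Fin n → ℝ, ∃ S : Matrix (Fin 3) (Fin 3) ℝ, IsUnit S ∧
        ∃ D : Fin 3 → ℝ, S⁻¹ * (∑ i, ξ i • A i) * S = Matrix.diagonal D) →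
      ∃ T : Matrix (Fin 3) (Fin 3) ℝ, IsUnit T ∧ ∀ i, (T⁻¹ * A i * T).IsSymm) →
    (∀ (n : ℕ) (A : Fin n → Matrix (Fin 3) (Fin 3) ℝ), 4 ≤ n →
      LinearIndependent ℝ (Fin.cons (1 : Matrix (Fin 3) (Fin 3) ℝ) A) →
      (∀ (ξ : Fin n → ℝ) (z : ℂ),
        ((∑ i, ξ i • A i).map (algebraMap ℝ ℂ) - z • (1 : Matrix (Fin 3) (Fin 3) ℂ)).det = 0 →
          z.im = 0) →
      (¬ ∀ ξ : Fin n → ℝ, ∃ S : Matrix (Fin 3) (Fin 3) ℝ, IsUnit S ∧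
        ∃ D : Fin 3 → ℝ, S⁻¹ * (∑ i, ξ i • A i) * S = Matrix.diagonal D) →
      (∃ v : Fin 3 → ℝ, v ≠ 0 ∧ ∀ i, ∃ μ : ℝ, (A i).mulVec v = μ • v) ∨
      (∃ w : Fin 3 → ℝ, w ≠ 0 ∧ ∀ i, ∃ μ : ℝ, Matrix.vecMul w (A i) = μ • w)) →
    ∀ (n : ℕ) (P : (Fin n → ℝ) →ₗ[ℝ] Matrix (Fin 3) (Fin 3) ℝ),
      (∀ (x : Fin n → ℝ) (z : ℂ),
        ((P x).map (algebraMap ℝ ℂ) - z • (1 : Matrix (Fin 3) (Fin 3) ℂ)).det = 0 → z.im = 0) →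
      (∀ W : Submodule ℝ (Fin 3 → ℝ), (∀ (x : Fin n → ℝ), ∀ v ∈ W, Matrix.mulVec (P x) v ∈ W) →
        W = ⊥ ∨ W = ⊤) →
      (¬ ∃ S : Matrix (Fin 3) (Fin 3) ℝ, S.PosDef ∧ ∀ x : Fin n → ℝ, (S * P x).IsSymm) →
      Module.finrank ℝ (Submodule.span ℝ
        (insert (1 : Matrix (Fin 3) (Fin 3) ℝ) (Set.range P))) ≤ 4 := by
  intro hO1 hO2 n P hP hirr hns
  classical
  by_contra hlt
  rw [not_le] at hlt
  -- the space `V = span (1, range P)`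
  set V : Submodule ℝ (Matrix (Fin 3) (Fin 3) ℝ) :=
    Submodule.span ℝ (insert (1 : Matrix (Fin 3) (Fin 3) ℝ) (Set.range P)) with hV
  have h1V : (1 : Matrix (Fin 3) (Fin 3) ℝ) ∈ V := Submodule.subset_span (Set.mem_insert _ _)
  have hPV : ∀ x, P x ∈ V := fun x =>
    Submodule.subset_span (Set.mem_insert_of_mem _ (Set.mem_range_self x))
  -- every element of `V` has only real eigenvalues
  have hRSV : ∀ M ∈ V, ∀ z : ℂ,
      (M.map (algebraMap ℝ ℂ) - z • (1 : Matrix (Fin 3) (Fin 3) ℂ)).det = 0 → z.im = 0 := by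
    intro M hM z hz
    rw [Submodule.mem_span_insert] at hM
    obtain ⟨a, Q, hQ, rfl⟩ := hM
    have hQ' : Q ∈ LinearMap.range P :=
      (Submodule.span_le.mpr (Set.range_subset_iff.mpr fun x => LinearMap.mem_range_self P x)) hQ
    obtain ⟨x, rfl⟩ := LinearMap.mem_range.1 hQ'
    rw [permanentalCones_map_smul_one_add_sub] at hz
    have him := hP x (z - (a : ℂ)) hz
    rwa [Complex.sub_im, Complex.ofReal_im, sub_zero] at him
  -- split `V = ℝ·1 ⊕ q`: a complement `q₀` of `p := ℝ·1`, cut down to `V` by the modular law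
  set p : Submodule ℝ (Matrix (Fin 3) (Fin 3) ℝ) := ℝ ∙ (1 : Matrix (Fin 3) (Fin 3) ℝ) with hp
  have hpV : p ≤ V := (Submodule.span_singleton_le_iff_mem _ _).2 h1V
  obtain ⟨q₀, hq₀⟩ := Submodule.exists_isCompl p
  obtain ⟨q, hqV, hdisj, hsup⟩ : ∃ q : Submodule ℝ (Matrix (Fin 3) (Fin 3) ℝ),
      q ≤ V ∧ p ⊓ q = ⊥ ∧ p ⊔ q = V :=
    ⟨q₀ ⊓ V, inf_le_right, (hq₀.disjoint.mono_right inf_le_left).eq_bot, by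
      rw [← sup_inf_assoc_of_le q₀ hpV, hq₀.sup_eq_top, top_inf_eq]⟩
  have hfp : Module.finrank ℝ p = 1 := finrank_span_singleton one_ne_zero
  have hfpq : Module.finrank ℝ V + 0 = Module.finrank ℝ p + Module.finrank ℝ q := by
    have h := Submodule.finrank_sup_add_finrank_inf_eq p q
    rwa [hsup, hdisj, finrank_bot] at h
  obtain ⟨m, hm⟩ : ∃ m : ℕ, Module.finrank ℝ q = m := ⟨_, rfl⟩
  have hm4 : 4 ≤ m := by omega
  -- the family `A`: a basis of `q`
  set bq : Module.Basis (Fin m) ℝ q := Module.finBasisOfFinrankEq ℝ q hm with hbq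
  obtain ⟨A, hA⟩ : ∃ A : Fin m → Matrix (Fin 3) (Fin 3) ℝ,
      ∀ i, A i = (bq i : Matrix (Fin 3) (Fin 3) ℝ) :=
    ⟨fun i => (bq i : Matrix (Fin 3) (Fin 3) ℝ), fun i => rfl⟩
  have hAq : ∀ i, A i ∈ q := fun i => by
    rw [hA]
    exact (bq i).2
  have hAV : ∀ i, A i ∈ V := fun i => hqV (hAq i)
  -- (a) `1, A₀, …, A_{m-1}` is linearly independent
  have hAli : LinearIndependent ℝ A := by
    have hAeq : A = Subtype.val ∘ bq := funext fun i => hA i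
    rw [hAeq]
    exact bq.linearIndependent.map' q.subtype q.ker_subtype
  have hspanA : Submodule.span ℝ (Set.range A) ≤ q := by
    rw [Submodule.span_le]
    rintro _ ⟨i, rfl⟩
    exact hAq i
  have h1A : (1 : Matrix (Fin 3) (Fin 3) ℝ) ∉ Submodule.span ℝ (Set.range A) := by
    intro h1
    have h10 : (1 : Matrix (Fin 3) (Fin 3) ℝ) ∈ p ⊓ q :=
      Submodule.mem_inf.2 ⟨Submodule.mem_span_singleton_self _, hspanA h1⟩
    rw [hdisj, Submodule.mem_bot] at h10
    exact one_ne_zero h10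
  have hlinA : LinearIndependent ℝ (Fin.cons (1 : Matrix (Fin 3) (Fin 3) ℝ) A) :=
    linearIndependent_finCons.2 ⟨hAli, h1A⟩
  -- (b) every real combination of the `Aᵢ` has only real eigenvalues
  have hRSA : ∀ (ξ : Fin m → ℝ) (z : ℂ),
      ((∑ i, ξ i • A i).map (algebraMap ℝ ℂ) - z • (1 : Matrix (Fin 3) (Fin 3) ℂ)).det = 0 →
        z.im = 0 :=
    fun ξ z hz => hRSV _ (Submodule.sum_mem V fun i _ => Submodule.smul_mem V (ξ i) (hAV i)) z hz
  -- (c) `V ⊆ span (1, A)`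
  have hqA : ∀ z ∈ q, z ∈ Submodule.span ℝ (Set.range A) := by
    intro z hz
    have h : ∑ i, bq.repr ⟨z, hz⟩ i • (bq i : Matrix (Fin 3) (Fin 3) ℝ) = z := by
      have h' := congrArg Subtype.val (bq.sum_repr ⟨z, hz⟩)
      simpa only [Submodule.coe_sum, Submodule.coe_smul] using h'
    rw [← h]
    exact Submodule.sum_mem _ fun i _ =>
      Submodule.smul_mem _ _ (Submodule.subset_span ⟨i, hA i⟩)
  have hVU : ∀ M ∈ V,
      M ∈ Submodule.span ℝ (insert (1 : Matrix (Fin 3) (Fin 3) ℝ) (Set.range A)) := by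
    intro M hM
    rw [← hsup] at hM
    obtain ⟨y, hy, z, hz, rfl⟩ := Submodule.mem_sup.1 hM
    obtain ⟨a, rfl⟩ := Submodule.mem_span_singleton.1 hy
    exact Submodule.add_mem _ (Submodule.smul_mem _ a (Submodule.subset_span (Set.mem_insert _ _)))
      (Submodule.span_mono (Set.subset_insert _ _) (hqA z hz))
  -- case distinction on the real-diagonalizability of the family `A`
  by_cases hdiag : ∀ ξ : Fin m → ℝ, ∃ S : Matrix (Fin 3) (Fin 3) ℝ, IsUnit S ∧
      ∃ D : Fin 3 → ℝ, S⁻¹ * (∑ i, ξ i • A i) * S = Matrix.diagonal D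
  · -- O₁: symmetrisable by a similarity `T`, hence by the positive definite `(T⁻¹)ᵀ T⁻¹`
    obtain ⟨T, hT, hTsymm⟩ := hO1 m A hm4 hlinA hdiag
    have hTB : T * T⁻¹ = 1 := Matrix.mul_nonsing_inv T ((Matrix.isUnit_iff_isUnit_det T).1 hT)
    have hBunit : IsUnit T⁻¹ := Matrix.isUnit_nonsing_inv_iff.2 hT
    apply hns
    refine ⟨(T⁻¹)ᵀ * T⁻¹, ?_, fun x => ?_⟩
    · have h := Matrix.PosDef.conjTranspose_mul_self T⁻¹
        (Matrix.mulVec_injective_of_isUnit hBunit)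
      rwa [Matrix.conjTranspose_eq_transpose_of_trivial] at h
    · have key : ∀ M ∈ Submodule.span ℝ (insert (1 : Matrix (Fin 3) (Fin 3) ℝ) (Set.range A)),
          ((T⁻¹)ᵀ * T⁻¹ * M).IsSymm := by
        intro M hM
        induction hM using Submodule.span_induction with
        | mem M hM =>
          rcases hM with rfl | ⟨i, rfl⟩
          · rw [Matrix.mul_one]
            exact Matrix.isSymm_transpose_mul_self _
          · have h : (T⁻¹)ᵀ * T⁻¹ * A i = (T⁻¹)ᵀ * (T⁻¹ * A i * T) * T⁻¹ := by
              simp only [Matrix.mul_assoc, hTB, Matrix.mul_one]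
            rw [h]
            exact permanentalCones_isSymm_transpose_mul_mul (hTsymm i) _
        | zero =>
          rw [Matrix.mul_zero]
          exact Matrix.isSymm_zero
        | add M M' _ _ hM hM' =>
          rw [Matrix.mul_add]
          exact hM.add hM'
        | smul a M _ hM =>
          rw [Matrix.mul_smul]
          exact hM.smul a
      exact key _ (hVU _ (hPV x))
  · -- O₂: a common right or left eigenvector, hence a proper invariant subspace
    rcases hO2 m A hm4 hlinA hRSA hdiag with ⟨v, hv, hAv⟩ | ⟨w, hw, hAw⟩
    · -- common right eigenvector: the line `ℝ ∙ v` is invariant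
      have key : ∀ M ∈ Submodule.span ℝ (insert (1 : Matrix (Fin 3) (Fin 3) ℝ) (Set.range A)),
          M *ᵥ v ∈ (ℝ ∙ v) := by
        intro M hM
        induction hM using Submodule.span_induction with
        | mem M hM =>
          rcases hM with rfl | ⟨i, rfl⟩
          · rw [Matrix.one_mulVec]
            exact Submodule.mem_span_singleton_self v
          · obtain ⟨μ, hμ⟩ := hAv i
            rw [hμ]
            exact Submodule.smul_mem _ μ (Submodule.mem_span_singleton_self v)
        | zero =>
          rw [Matrix.zero_mulVec]
          exact Submodule.zero_mem _
        | add M M' _ _ hM hM' =>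
          rw [Matrix.add_mulVec]
          exact Submodule.add_mem _ hM hM'
        | smul a M _ hM =>
          rw [Matrix.smul_mulVec]
          exact Submodule.smul_mem _ a hM
      have hinv : ∀ x : Fin n → ℝ, ∀ u ∈ (ℝ ∙ v), (P x) *ᵥ u ∈ (ℝ ∙ v) := by
        intro x u hu
        obtain ⟨t, rfl⟩ := Submodule.mem_span_singleton.1 hu
        rw [Matrix.mulVec_smul]
        exact Submodule.smul_mem _ t (key _ (hVU _ (hPV x)))
      rcases hirr _ hinv with hbot | htop
      · exact hv (Submodule.span_singleton_eq_bot.1 hbot)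
      · have h := finrank_span_singleton (K := ℝ) hv
        rw [htop, finrank_top, Module.finrank_fin_fun] at h
        omega
    · -- common left eigenvector: the plane `w^⊥ = ker (w ⬝ᵥ ·)` is invariant
      have key : ∀ M ∈ Submodule.span ℝ (insert (1 : Matrix (Fin 3) (Fin 3) ℝ) (Set.range A)),
          w ᵥ* M ∈ (ℝ ∙ w) := by
        intro M hM
        induction hM using Submodule.span_induction with
        | mem M hM =>
          rcases hM with rfl | ⟨i, rfl⟩
          · rw [Matrix.vecMul_one]
            exact Submodule.mem_span_singleton_self w
          · obtain ⟨μ, hμ⟩ := hAw i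
            rw [hμ]
            exact Submodule.smul_mem _ μ (Submodule.mem_span_singleton_self w)
        | zero =>
          rw [Matrix.vecMul_zero]
          exact Submodule.zero_mem _
        | add M M' _ _ hM hM' =>
          rw [Matrix.vecMul_add]
          exact Submodule.add_mem _ hM hM'
        | smul a M _ hM =>
          rw [Matrix.vecMul_smul]
          exact Submodule.smul_mem _ a hM
      obtain ⟨φ, hφ⟩ : ∃ φ : (Fin 3 → ℝ) →ₗ[ℝ] ℝ, ∀ u, φ u = w ⬝ᵥ u :=
        ⟨{ toFun := fun u => w ⬝ᵥ u
           map_add' := fun u u' => by simp only [dotProduct_add]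
           map_smul' := fun c u => by simp only [dotProduct_smul, smul_eq_mul, RingHom.id_apply] },
          fun u => rfl⟩
      have hinv : ∀ x : Fin n → ℝ, ∀ u ∈ LinearMap.ker φ, (P x) *ᵥ u ∈ LinearMap.ker φ := by
        intro x u hu
        rw [LinearMap.mem_ker, hφ] at hu ⊢
        obtain ⟨t, ht⟩ := Submodule.mem_span_singleton.1 (key _ (hVU _ (hPV x)))
        rw [Matrix.dotProduct_mulVec, ← ht, smul_dotProduct, hu, smul_zero]
      rcases hirr _ hinv with hbot | htop
      · have h := LinearMap.finrank_le_finrank_of_injective (LinearMap.ker_eq_bot.1 hbot)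
        rw [Module.finrank_fin_fun, Module.finrank_self] at h
        omega
      · have hwk : w ∈ LinearMap.ker φ := htop ▸ Submodule.mem_top
        rw [LinearMap.mem_ker, hφ] at hwk
        exact hw (dotProduct_self_eq_zero.1 hwk)

end Summit.ValiantsHypothesis.ValiantsHypothesis.Theorems
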